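import Literature.NumberTheory.Sieve.CFSemigroupEigenfunctionSmooth
import Literature.NumberTheory.Sieve.CFCongruenceTransferBridge
import Literature.NumberTheory.Sieve.CFSemigroupLipRPF
import HarnessLib

/-!
# The renormalised transfer operator and the a priori bounds (Magee–Oh–Winter §4.2, Lemma 23 (i))

Support file (all results proved) for the programme of proving [MageeOhWinter2019, Thm. 4 (2)] (Dolgopyat
bounds) for the continued-fractions semigroup `Γ_A`, in the scalar (level `q = 1`) letter-operator form.
[MageeOhWinter2019, §4.2, before Lemma 22]: "for `s = a + ib` let us define another piece of notation by
`τ_a^N = -s τ^N - N P(-aτ) + log h_{-aτ} - log(h_{-aτ} ∘ T^N)`, let `L_{s,q}` denote the transfer operator on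
`C¹(I; ℂ^{Γ_q})` given by `L_{s,q} f = e^{-P(-aτ)} M_{h_{-aτ}}^{-1} 𝓛_{s,q} M_{h_{-aτ}}` … `L_a 1 = 1`", and
[MageeOhWinter2019, Lemma 23 (1)] (a priori bound, after Naud Lemma 5.2):
`‖[L_{s,q}^n f]'‖ ≤ κ₁|b| ‖L_a^n|f|‖ + R^n ‖L_a^n|f'|‖`.

Here, with the `C¹` eigenfunction `h_a` of `CFSemigroupEigenfunctionSmooth.lean` (`L_a h_a = λ_a h_a`,
`|h_a'| ≤ 2a h_a`):

* `cfHfun`, `cfHder` — `h_a`, `h_a'` (chosen), with their properties (`cfHfun_spec`, …);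
* `cfLRn a b n f x = (λ_a^n h_a(x))⁻¹ Σ_{|w|=n} W_w^{(s)}(x) h_a(M_w x) f(M_w x)` — the `n`-th iterate of the
  renormalised complex operator `L̃_s = λ_a⁻¹ M_{h_a}⁻¹ L_s M_{h_a}` in word-sum form
  (`cfLRn_eq_iterate`: `= (λ_a^n h_a(x))⁻¹ (L_s^n (h_a f))(x)` on `[0,1]`);
* `cfLRa a n g x` — the positive operator `L̃_a^n` on real functions; `cfLRa_one : L̃_a^n 1 = 1` (normalisation),
  `norm_cfLRn_le : ‖L̃_s^n f‖ ≤ L̃_a^n ‖f‖` pointwise;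
* `exists_hasDerivWithinAt_cfLRn` — **the a priori bound [Lemma 23 (1)]** in pointwise form: on `[0,1]`,
  `L̃_s^n f` has a derivative `D` within `[0,1]` with
  `‖D‖ ≤ (4a + 2‖s‖) L̃_a^n‖f‖(x) + 2 (1/2)^n L̃_a^n‖f'‖(x)` (the contraction `|M_w'| ≤ q_w^{-2} ≤ 2(1/2)^n`
  supplies `R = 1/2`, the cone constants `2a` of `h_a` and `2‖s‖` of the weights supply `κ₁|b|`).

## References

* [MageeOhWinter2019] M. Magee, H. Oh, D. Winter, J. reine angew. Math. 753 (2019) 89–135, §4.2 (eq. (4.3)–(4.5)),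
  Lemma 23 (after F. Naud, Ann. Sci. ÉNS 38 (2005), Lemma 5.2).
-/

noncomputable section

open Set Filter Complex
open scoped Topology

namespace Literature.NumberTheory.Sieve

variable {A : Finset ℕ} (hA : ∀ a ∈ A, 1 ≤ a)

/-! ### The `C¹` eigenfunction `h_a` -/

/-- The positive `C¹` eigenfunction `h_a` of `L_a` (`a ≥ 0` real), chosen. [cite: MageeOhWinter2019, Thm. 10 (3)] -/
def cfHfun (hA : ∀ a ∈ A, 1 ≤ a) (hne : A.Nonempty) {a : ℝ} (ha : 0 ≤ a) : ℝ → ℝ :=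
  Classical.choose (exists_contDiff_eigenfunction hA hne ha)

/-- Its derivative `h_a'` on `[0,1]`, chosen. [folklore] -/
def cfHder (hA : ∀ a ∈ A, 1 ≤ a) (hne : A.Nonempty) {a : ℝ} (ha : 0 ≤ a) : ℝ → ℝ :=
  Classical.choose (Classical.choose_spec (exists_contDiff_eigenfunction hA hne ha))

section H

/-- The defining properties of `h_a`, `h_a'` (bounds, eigen-equation, derivative, continuity, cone). [cite: MageeOhWinter2019, Thm. 10 (3) and §2.2] -/
theorem cfHfun_spec (hne : A.Nonempty) {a : ℝ} (ha : 0 ≤ a) :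
    (∀ x ∈ Icc (0 : ℝ) 1, cfHfun hA hne ha x ∈ Icc ((4 : ℝ) ^ (-a)) ((4 : ℝ) ^ a)) ∧
      (∀ x ∈ Icc (0 : ℝ) 1, cfTransfer A a (cfHfun hA hne ha) x = cfEig A a * cfHfun hA hne ha x) ∧
      (∀ x ∈ Icc (0 : ℝ) 1, HasDerivWithinAt (cfHfun hA hne ha) (cfHder hA hne ha x) (Icc (0 : ℝ) 1) x) ∧
      ContinuousOn (cfHder hA hne ha) (Icc (0 : ℝ) 1) ∧
      (∀ x ∈ Icc (0 : ℝ) 1, |cfHder hA hne ha x| ≤ 2 * a * cfHfun hA hne ha x) :=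
  Classical.choose_spec (Classical.choose_spec (exists_contDiff_eigenfunction hA hne ha))

/-- `h_a > 0` on `[0,1]` (indeed `≥ 4^{-a}`). [cite: MageeOhWinter2019, Thm. 10 (3)] -/
theorem cfHfun_pos (hne : A.Nonempty) {a : ℝ} (ha : 0 ≤ a) {x : ℝ} (hx : x ∈ Icc (0 : ℝ) 1) : 0 < cfHfun hA hne ha x :=
  lt_of_lt_of_le (Real.rpow_pos_of_pos (by norm_num) _) ((cfHfun_spec hA hne ha).1 x hx).1

/-- `h_a ≤ 4^a` on `[0,1]`. [folklore] -/
theorem cfHfun_le (hne : A.Nonempty) {a : ℝ} (ha : 0 ≤ a) {x : ℝ} (hx : x ∈ Icc (0 : ℝ) 1) : cfHfun hA hne ha x ≤ (4 : ℝ) ^ a :=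
  ((cfHfun_spec hA hne ha).1 x hx).2

/-- `4^{-a} ≤ h_a` on `[0,1]`. [folklore] -/
theorem le_cfHfun (hne : A.Nonempty) {a : ℝ} (ha : 0 ≤ a) {x : ℝ} (hx : x ∈ Icc (0 : ℝ) 1) : (4 : ℝ) ^ (-a) ≤ cfHfun hA hne ha x :=
  ((cfHfun_spec hA hne ha).1 x hx).1

/-- The eigen-equation `L_a h_a = λ_a h_a` on `[0,1]`. [cite: MageeOhWinter2019, Thm. 10 (3)] -/
theorem cfTransfer_cfHfun (hne : A.Nonempty) {a : ℝ} (ha : 0 ≤ a) {x : ℝ} (hx : x ∈ Icc (0 : ℝ) 1) :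
    cfTransfer A a (cfHfun hA hne ha) x = cfEig A a * cfHfun hA hne ha x := (cfHfun_spec hA hne ha).2.1 x hx

/-- `h_a` is differentiable within `[0,1]` with derivative `h_a'`. [cite: MageeOhWinter2019, §2.2] -/
theorem hasDerivWithinAt_cfHfun (hne : A.Nonempty) {a : ℝ} (ha : 0 ≤ a) {x : ℝ} (hx : x ∈ Icc (0 : ℝ) 1) :
    HasDerivWithinAt (cfHfun hA hne ha) (cfHder hA hne ha x) (Icc (0 : ℝ) 1) x := (cfHfun_spec hA hne ha).2.2.1 x hx

/-- The cone bound `|h_a'| ≤ 2a h_a`. [cite: MageeOhWinter2019, §4.3] -/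
theorem abs_cfHder_le (hne : A.Nonempty) {a : ℝ} (ha : 0 ≤ a) {x : ℝ} (hx : x ∈ Icc (0 : ℝ) 1) : |cfHder hA hne ha x| ≤ 2 * a * cfHfun hA hne ha x :=
  (cfHfun_spec hA hne ha).2.2.2.2 x hx

/-- The iterated eigen-equation in word-sum form: `Σ_{|w|=n} (denom_w²)^{-a} h_a(M_w x) = λ_a^n h_a(x)`. [folklore] -/
theorem sum_cfRealWt_cfHfun (hne : A.Nonempty) {a : ℝ} (ha : 0 ≤ a) {x : ℝ} (hx : x ∈ Icc (0 : ℝ) 1) (n : ℕ) :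
    ∑ w : Fin n → A, cfRealWt a w x * cfHfun hA hne ha (cfMoeb (cfMat fun i => (w i : ℕ)) x) =
      cfEig A a ^ n * cfHfun hA hne ha x := by
  have hit := cfTransfer_iterate_of_eigen hA (cfHfun_spec hA hne ha).2.1 n hx
  rw [cfTransfer_iterate hA a _ n hx, cfTransferSum] at hit
  exact hit

end H

/-! ### The renormalised operators `L̃_s^n` and `L̃_a^n` -/

section Renorm

/-- **The `n`-th iterate of the renormalised complex transfer operator** `L̃_s = λ_a⁻¹ M_{h_a}⁻¹ L_s M_{h_a}`,
`s = a + ib`, in word-sum form: `(L̃_s^n f)(x) = (λ_a^n h_a(x))⁻¹ Σ_{|w|=n} W_w^{(s)}(x) h_a(M_w x) f(M_w x)`.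
[cite: MageeOhWinter2019, §4.2 eq. (4.4)] -/
def cfLRn (hA : ∀ a ∈ A, 1 ≤ a) (hne : A.Nonempty) {a : ℝ} (ha : 0 ≤ a) (b : ℝ) (n : ℕ) (f : ℝ → ℂ) (x : ℝ) : ℂ :=
  (((cfEig A a ^ n * cfHfun hA hne ha x)⁻¹ : ℝ) : ℂ) *
    ∑ w : Fin n → A, cfWt ((a : ℂ) + b * I) (cfMat fun i => (w i : ℕ)) x *
      ((cfHfun hA hne ha (cfMoeb (cfMat fun i => (w i : ℕ)) x) : ℂ) * f (cfMoeb (cfMat fun i => (w i : ℕ)) x))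

/-- **The positive operator `L̃_a^n`** on real functions:
`(L̃_a^n g)(x) = (λ_a^n h_a(x))⁻¹ Σ_{|w|=n} (denom_w(x)²)^{-a} h_a(M_w x) g(M_w x)`. [cite: MageeOhWinter2019, §4.2 eq. (4.5)] -/
def cfLRa (hA : ∀ a ∈ A, 1 ≤ a) (hne : A.Nonempty) {a : ℝ} (ha : 0 ≤ a) (n : ℕ) (g : ℝ → ℝ) (x : ℝ) : ℝ :=
  (cfEig A a ^ n * cfHfun hA hne ha x)⁻¹ *
    ∑ w : Fin n → A, cfRealWt a w x * cfHfun hA hne ha (cfMoeb (cfMat fun i => (w i : ℕ)) x) * g (cfMoeb (cfMat fun i => (w i : ℕ)) x)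

/-- **Normalisation `L̃_a^n 1 = 1`** on `[0,1]`. [cite: MageeOhWinter2019, §4.2 eq. (4.5)] -/
theorem cfLRa_one (hne : A.Nonempty) {a : ℝ} (ha : 0 ≤ a) {x : ℝ} (hx : x ∈ Icc (0 : ℝ) 1) (n : ℕ) : cfLRa hA hne ha n (fun _ => 1) x = 1 := by
  have hpos : 0 < cfEig A a ^ n * cfHfun hA hne ha x := mul_pos (pow_pos (cfEig_pos a) n) (cfHfun_pos hA hne ha hx)
  unfold cfLRa
  simp only [mul_one]
  rw [sum_cfRealWt_cfHfun hA hne ha hx n, inv_mul_cancel₀ hpos.ne']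

/-- `L̃_a^n` is monotone: `g₁ ≤ g₂` on `[0,1]` ⇒ `L̃_a^n g₁ ≤ L̃_a^n g₂` on `[0,1]`. [folklore] -/
theorem cfLRa_mono (hne : A.Nonempty) {a : ℝ} (ha : 0 ≤ a) {g₁ g₂ : ℝ → ℝ} (hg : ∀ y ∈ Icc (0 : ℝ) 1, g₁ y ≤ g₂ y) {x : ℝ} (hx : x ∈ Icc (0 : ℝ) 1) (n : ℕ) :
    cfLRa hA hne ha n g₁ x ≤ cfLRa hA hne ha n g₂ x := by
  have hpos : 0 < cfEig A a ^ n * cfHfun hA hne ha x := mul_pos (pow_pos (cfEig_pos a) n) (cfHfun_pos hA hne ha hx)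
  unfold cfLRa
  refine mul_le_mul_of_nonneg_left (Finset.sum_le_sum fun w _ => ?_) (inv_nonneg.2 hpos.le)
  have hw := one_le_coe_digit hA w
  have hm := cfMoeb_cfMat_mem hw hx
  exact mul_le_mul_of_nonneg_left (hg _ hm) (mul_nonneg (cfRealWt_pos hA a w hx).le (cfHfun_pos hA hne ha hm).le)

/-- `L̃_a^n g ≥ 0` for `g ≥ 0`. [folklore] -/
theorem cfLRa_nonneg (hne : A.Nonempty) {a : ℝ} (ha : 0 ≤ a) {g : ℝ → ℝ} (hg : ∀ y ∈ Icc (0 : ℝ) 1, 0 ≤ g y) {x : ℝ} (hx : x ∈ Icc (0 : ℝ) 1) (n : ℕ) :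
    0 ≤ cfLRa hA hne ha n g x := by
  have hpos : 0 < cfEig A a ^ n * cfHfun hA hne ha x := mul_pos (pow_pos (cfEig_pos a) n) (cfHfun_pos hA hne ha hx)
  unfold cfLRa
  refine mul_nonneg (inv_nonneg.2 hpos.le) (Finset.sum_nonneg fun w _ => ?_)
  have hw := one_le_coe_digit hA w
  have hm := cfMoeb_cfMat_mem hw hx
  exact mul_nonneg (mul_nonneg (cfRealWt_pos hA a w hx).le (cfHfun_pos hA hne ha hm).le) (hg _ hm)

/-- `L̃_a^n (c g) = c L̃_a^n g`. [folklore] -/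
theorem cfLRa_const_mul (hne : A.Nonempty) {a : ℝ} (ha : 0 ≤ a) (c : ℝ) (g : ℝ → ℝ) (x : ℝ) (n : ℕ) :
    cfLRa hA hne ha n (fun y => c * g y) x = c * cfLRa hA hne ha n g x := by
  unfold cfLRa
  rw [Finset.mul_sum, Finset.mul_sum, Finset.mul_sum]
  exact Finset.sum_congr rfl fun w _ => by ring

/-- `L̃_a^n (g₁ + g₂) = L̃_a^n g₁ + L̃_a^n g₂`. [folklore] -/
theorem cfLRa_add (hne : A.Nonempty) {a : ℝ} (ha : 0 ≤ a) (g₁ g₂ : ℝ → ℝ) (x : ℝ) (n : ℕ) :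
    cfLRa hA hne ha n (fun y => g₁ y + g₂ y) x = cfLRa hA hne ha n g₁ x + cfLRa hA hne ha n g₂ x := by
  unfold cfLRa
  rw [← mul_add, ← Finset.sum_add_distrib]
  congr 1
  exact Finset.sum_congr rfl fun w _ => by ring

include hA in
/-- The modulus of the complex word weight is the real weight: `‖W_w^{(a+ib)}(x)‖ = (denom_w(x)²)^{-a}`. [folklore] -/
theorem norm_cfWt_word {a : ℝ} (b : ℝ) {n : ℕ} (w : Fin n → A) {x : ℝ} (hx : x ∈ Icc (0 : ℝ) 1) :
    ‖cfWt ((a : ℂ) + b * I) (cfMat fun i => (w i : ℕ)) x‖ = cfRealWt a w x := by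
  rw [norm_cfWt _ _ (cfDenom_cfMat_pos (one_le_coe_digit hA w) hx), cfRealWt]
  congr 1
  simp

/-- **Pointwise domination `‖L̃_s^n f‖ ≤ L̃_a^n ‖f‖`** on `[0,1]`. [cite: MageeOhWinter2019, §4.2] -/
theorem norm_cfLRn_le (hne : A.Nonempty) {a : ℝ} (ha : 0 ≤ a) (b : ℝ) (n : ℕ) (f : ℝ → ℂ) {x : ℝ} (hx : x ∈ Icc (0 : ℝ) 1) :
    ‖cfLRn hA hne ha b n f x‖ ≤ cfLRa hA hne ha n (fun y => ‖f y‖) x := by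
  have hpos : 0 < cfEig A a ^ n * cfHfun hA hne ha x := mul_pos (pow_pos (cfEig_pos a) n) (cfHfun_pos hA hne ha hx)
  unfold cfLRn cfLRa
  rw [norm_mul, Complex.norm_real, Real.norm_eq_abs, abs_of_pos (inv_pos.2 hpos)]
  refine mul_le_mul_of_nonneg_left ((norm_sum_le _ _).trans (Finset.sum_le_sum fun w _ => ?_)) (inv_nonneg.2 hpos.le)
  have hw := one_le_coe_digit hA w
  have hm := cfMoeb_cfMat_mem hw hx
  simp only [norm_mul, norm_cfWt_word hA b w hx, Complex.norm_real, Real.norm_eq_abs,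
    abs_of_pos (cfHfun_pos hA hne ha hm), mul_assoc, le_refl]

/-- **`L̃_s^n` is the conjugated iterate:** `(L̃_s^n f)(x) = (λ_a^n h_a(x))⁻¹ (L_s^n (h_a f))(x)` on `[0,1]`.
[cite: MageeOhWinter2019, §4.2 eq. (4.4)] -/
theorem cfLRn_eq_iterate (hne : A.Nonempty) {a : ℝ} (ha : 0 ≤ a) (b : ℝ) (n : ℕ) (f : ℝ → ℂ) {x : ℝ} (hx : x ∈ Icc (0 : ℝ) 1) :
    cfLRn hA hne ha b n f x = (((cfEig A a ^ n * cfHfun hA hne ha x)⁻¹ : ℝ) : ℂ) *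
      (cfLC A ((a : ℂ) + b * I))^[n] (fun y => (cfHfun hA hne ha y : ℂ) * f y) x := by
  rw [cfLC_iterate hA _ _ n hx, cfLCSum, cfLRn]

end Renorm

/-! ### The a priori bound for the derivative (Lemma 23 (1)) -/

section APriori

include hA in
/-- `|M_w'(x)| = denom_w(x)^{-2} ≤ min(1, 2 (1/2)^n)` on `[0,1]`. [cite: MageeOhWinter2019, Prop. 5] -/
theorem abs_deriv_cfMoeb_word_le {n : ℕ} (w : Fin n → A) {x : ℝ} (hx : x ∈ Icc (0 : ℝ) 1) :
    |(((cfMat fun i => (w i : ℕ)).det : ℝ)) / (cfDenom (cfMat fun i => (w i : ℕ)) x) ^ 2| ≤ 1 ∧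
      |(((cfMat fun i => (w i : ℕ)).det : ℝ)) / (cfDenom (cfMat fun i => (w i : ℕ)) x) ^ 2| ≤ 2 * (1 / 2) ^ n := by
  have hw := one_le_coe_digit hA w
  have hd := cfDenom_cfMat_pos hw hx
  have hq := (cfDenom_cfMat_mem hw hx).1
  have hq1 : (1 : ℝ) ≤ (cfQ (fun i => (w i : ℕ)) : ℝ) := by exact_mod_cast one_le_cfQ hw
  have hdet : |(((cfMat fun i => (w i : ℕ)).det : ℝ))| = 1 := by
    rw [cfMat, det_cfWord]; push_cast; simp
  rw [abs_div, hdet, abs_of_pos (pow_pos hd 2)]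
  have hqsq : (2 : ℝ) ^ (n - 1) ≤ (cfQ (fun i => (w i : ℕ)) : ℝ) ^ 2 := by exact_mod_cast pow_le_cfQ_sq hw
  have hd2 : (cfQ (fun i => (w i : ℕ)) : ℝ) ^ 2 ≤ (cfDenom (cfMat fun i => (w i : ℕ)) x) ^ 2 := by nlinarith
  constructor
  · rw [div_le_one (pow_pos hd 2)]; nlinarith
  · rw [div_le_iff₀ (pow_pos hd 2)]
    have h2 : 1 ≤ 2 * (1 / 2 : ℝ) ^ n * (2 : ℝ) ^ (n - 1) := by
      rcases n with _ | k
      · norm_num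
      · rw [Nat.add_sub_cancel, pow_succ]
        have : (1 / 2 : ℝ) ^ k * 2 ^ k = 1 := by rw [← mul_pow]; norm_num
        nlinarith [this]
    nlinarith [mul_le_mul_of_nonneg_left (hqsq.trans hd2) (by positivity : (0:ℝ) ≤ 2 * (1 / 2) ^ n)]

/-- **Derivative of one term** `x ↦ W_w^{(s)}(x) h_a(M_w x) f(M_w x)` within `[0,1]`, with the bound
`‖·‖ ≤ |W_w(x)| h_a(M_w x) ((2‖s‖ + 2a) ‖f(M_w x)‖ + 2(1/2)^n ‖f'(M_w x)‖)`. [cite: MageeOhWinter2019, Lemma 23 (1)] -/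
theorem exists_hasDerivWithinAt_term (hne : A.Nonempty) {a : ℝ} (ha : 0 ≤ a) (b : ℝ) {n : ℕ} (w : Fin n → A) {f f' : ℝ → ℂ}
    (hf : ∀ y ∈ Icc (0 : ℝ) 1, HasDerivWithinAt f (f' y) (Icc (0 : ℝ) 1) y) {x : ℝ} (hx : x ∈ Icc (0 : ℝ) 1) :
    ∃ D : ℂ, HasDerivWithinAt (fun y => cfWt ((a : ℂ) + b * I) (cfMat fun i => (w i : ℕ)) y *
        ((cfHfun hA hne ha (cfMoeb (cfMat fun i => (w i : ℕ)) y) : ℂ) * f (cfMoeb (cfMat fun i => (w i : ℕ)) y)))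
        D (Icc (0 : ℝ) 1) x ∧
      ‖D‖ ≤ cfRealWt a w x * cfHfun hA hne ha (cfMoeb (cfMat fun i => (w i : ℕ)) x) *
        ((2 * ‖(a : ℂ) + b * I‖ + 2 * a) * ‖f (cfMoeb (cfMat fun i => (w i : ℕ)) x)‖ +
          2 * (1 / 2) ^ n * ‖f' (cfMoeb (cfMat fun i => (w i : ℕ)) x)‖) := by
  set s : ℂ := (a : ℂ) + b * I with hs
  set M := cfMat fun i => (w i : ℕ) with hM
  set h := cfHfun hA hne ha with hh
  set h' := cfHder hA hne ha with hh'
  have hw := one_le_coe_digit hA w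
  have hd : 0 < cfDenom M x := cfDenom_cfMat_pos hw hx
  have hmx : cfMoeb M x ∈ Icc (0 : ℝ) 1 := cfMoeb_cfMat_mem hw hx
  have hmaps : MapsTo (cfMoeb M) (Icc (0 : ℝ) 1) (Icc (0 : ℝ) 1) := fun y hy => cfMoeb_cfMat_mem hw hy
  -- the pieces
  set M' : ℝ := ((M.det : ℝ)) / (cfDenom M x) ^ 2 with hM'
  have hMob : HasDerivWithinAt (cfMoeb M) M' (Icc (0 : ℝ) 1) x := (hasDerivAt_cfMoeb M hd.ne').hasDerivWithinAt
  have hW : HasDerivWithinAt (fun y => cfWt s M y) (cfWt s M x * (-(2 * s * (((M 1 0 : ℝ) / cfDenom M x : ℝ) : ℂ))))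
      (Icc (0 : ℝ) 1) x := (hasDerivAt_cfWt_real s M hd).hasDerivWithinAt
  have hhM : HasDerivWithinAt (fun y => ((h (cfMoeb M y) : ℝ) : ℂ)) (((h' (cfMoeb M x) * M' : ℝ) : ℂ)) (Icc (0 : ℝ) 1) x := by
    have h1 := (hasDerivWithinAt_cfHfun hA hne ha hmx).comp x hMob hmaps
    exact h1.ofReal_comp
  have hfM : HasDerivWithinAt (fun y => f (cfMoeb M y)) (M' • f' (cfMoeb M x)) (Icc (0 : ℝ) 1) x :=
    (hf _ hmx).scomp x hMob hmaps
  have hG := hhM.mul hfM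
  have hF := hW.mul hG
  refine ⟨_, hF, ?_⟩
  -- the bounds on the pieces
  have hWn : ‖cfWt s M x‖ = cfRealWt a w x := norm_cfWt_word hA b w hx
  have hratio : |(M 1 0 : ℝ) / cfDenom M x| ≤ 1 := by
    have h10 : (0 : ℝ) ≤ (M 1 0 : ℝ) := by rw [hM]; exact_mod_cast cfWord_nonneg _ _ 1 0
    have h10q : (M 1 0 : ℝ) ≤ (M 1 1 : ℝ) := by
      have := cfWord_10_le_cfDen (one_le_cfExt hw) n
      rw [hM]; exact_mod_cast this
    rw [abs_of_nonneg (div_nonneg h10 hd.le), div_le_one hd]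
    have : cfDenom M x = (M 1 0 : ℝ) * x + M 1 1 := rfl
    nlinarith [hx.1]
  have hWd : ‖cfWt s M x * (-(2 * s * (((M 1 0 : ℝ) / cfDenom M x : ℝ) : ℂ)))‖ ≤ cfRealWt a w x * (2 * ‖s‖) := by
    rw [norm_mul, hWn, norm_neg, norm_mul, norm_mul, Complex.norm_real, Real.norm_eq_abs, Complex.norm_two]
    have := (cfRealWt_pos hA a w hx).le
    calc cfRealWt a w x * (2 * ‖s‖ * |(M 1 0 : ℝ) / cfDenom M x|) ≤ cfRealWt a w x * (2 * ‖s‖ * 1) := by gcongr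
      _ = cfRealWt a w x * (2 * ‖s‖) := by ring
  obtain ⟨hM'1, hM'2⟩ := abs_deriv_cfMoeb_word_le hA w hx
  rw [← hM, ← hM'] at hM'1 hM'2
  have hhpos : 0 < h (cfMoeb M x) := cfHfun_pos hA hne ha hmx
  have hh'b : |h' (cfMoeb M x)| ≤ 2 * a * h (cfMoeb M x) := abs_cfHder_le hA hne ha hmx
  have hGn : ‖((h (cfMoeb M x) : ℝ) : ℂ) * f (cfMoeb M x)‖ = h (cfMoeb M x) * ‖f (cfMoeb M x)‖ := by
    rw [norm_mul, Complex.norm_real, Real.norm_eq_abs, abs_of_pos hhpos]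
  have hG'n : ‖(((h' (cfMoeb M x) * M' : ℝ) : ℂ)) * f (cfMoeb M x) + ((h (cfMoeb M x) : ℝ) : ℂ) * (M' • f' (cfMoeb M x))‖ ≤
      h (cfMoeb M x) * (2 * a * ‖f (cfMoeb M x)‖ + 2 * (1 / 2) ^ n * ‖f' (cfMoeb M x)‖) := by
    refine (norm_add_le _ _).trans ?_
    rw [norm_mul, Complex.norm_real, Real.norm_eq_abs, abs_mul, norm_mul, Complex.norm_real, Real.norm_eq_abs,
      abs_of_pos hhpos, norm_smul, Real.norm_eq_abs]
    have h1 : |h' (cfMoeb M x)| * |M'| * ‖f (cfMoeb M x)‖ ≤ 2 * a * h (cfMoeb M x) * 1 * ‖f (cfMoeb M x)‖ := by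
      gcongr
    have h2 : h (cfMoeb M x) * (|M'| * ‖f' (cfMoeb M x)‖) ≤ h (cfMoeb M x) * (2 * (1 / 2) ^ n * ‖f' (cfMoeb M x)‖) := by
      gcongr
    nlinarith [h1, h2]
  -- assemble: `‖W' G + W G'‖ ≤ ‖W'‖ ‖G‖ + ‖W‖ ‖G'‖`
  have hR := (cfRealWt_pos hA a w hx).le
  have hfn := norm_nonneg (f (cfMoeb M x))
  have hf'n := norm_nonneg (f' (cfMoeb M x))
  refine (norm_add_le _ _).trans ?_
  refine (add_le_add (norm_mul_le _ _) (norm_mul_le _ _)).trans ?_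
  simp only [Pi.mul_apply]
  rw [hGn, hWn]
  calc ‖cfWt s M x * (-(2 * s * (((M 1 0 : ℝ) / cfDenom M x : ℝ) : ℂ)))‖ * (h (cfMoeb M x) * ‖f (cfMoeb M x)‖) +
        cfRealWt a w x * ‖(((h' (cfMoeb M x) * M' : ℝ) : ℂ)) * f (cfMoeb M x) + ((h (cfMoeb M x) : ℝ) : ℂ) * (M' • f' (cfMoeb M x))‖
      ≤ cfRealWt a w x * (2 * ‖s‖) * (h (cfMoeb M x) * ‖f (cfMoeb M x)‖) +
        cfRealWt a w x * (h (cfMoeb M x) * (2 * a * ‖f (cfMoeb M x)‖ + 2 * (1 / 2) ^ n * ‖f' (cfMoeb M x)‖)) := by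
        gcongr
    _ = cfRealWt a w x * h (cfMoeb M x) * ((2 * ‖s‖ + 2 * a) * ‖f (cfMoeb M x)‖ + 2 * (1 / 2) ^ n * ‖f' (cfMoeb M x)‖) := by
        ring

/-- `HasDerivWithinAt` of a finite sum of functions (lambda form). [folklore] -/
theorem hasDerivWithinAt_fun_sum {ι : Type*} (u : Finset ι) {F : ι → ℝ → ℂ} {F' : ι → ℂ} {t : Set ℝ} {x : ℝ}
    (h : ∀ i ∈ u, HasDerivWithinAt (F i) (F' i) t x) :
    HasDerivWithinAt (fun y => ∑ i ∈ u, F i y) (∑ i ∈ u, F' i) t x := by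
  have hs := HasDerivWithinAt.sum h
  have e : (∑ i ∈ u, fun y => F i y) = fun y => ∑ i ∈ u, F i y := by funext y; simp only [Finset.sum_apply]
  simpa [e] using hs

/-- **The a priori bound [MageeOhWinter2019, Lemma 23 (1)]** (pointwise form, scalar letter operator): for
`f ∈ C¹([0,1]; ℂ)` (derivative `f'` within `[0,1]`), `s = a + ib`, `n ∈ ℕ` and `x ∈ [0,1]`, the function
`L̃_s^n f` has a derivative `D` within `[0,1]` at `x` with
`‖D‖ ≤ (4a + 2‖s‖) (L̃_a^n ‖f‖)(x) + 2 (1/2)^n (L̃_a^n ‖f'‖)(x)`. [cite: MageeOhWinter2019, Lemma 23 (1)] -/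
theorem exists_hasDerivWithinAt_cfLRn (hne : A.Nonempty) {a : ℝ} (ha : 0 ≤ a) (b : ℝ) (n : ℕ) {f f' : ℝ → ℂ}
    (hf : ∀ y ∈ Icc (0 : ℝ) 1, HasDerivWithinAt f (f' y) (Icc (0 : ℝ) 1) y) {x : ℝ} (hx : x ∈ Icc (0 : ℝ) 1) :
    ∃ D : ℂ, HasDerivWithinAt (cfLRn hA hne ha b n f) D (Icc (0 : ℝ) 1) x ∧
      ‖D‖ ≤ (4 * a + 2 * ‖(a : ℂ) + b * I‖) * cfLRa hA hne ha n (fun y => ‖f y‖) x +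
        2 * (1 / 2) ^ n * cfLRa hA hne ha n (fun y => ‖f' y‖) x := by
  set s : ℂ := (a : ℂ) + b * I with hs
  set h := cfHfun hA hne ha with hh
  set h' := cfHder hA hne ha with hh'
  set lam : ℝ := cfEig A a ^ n with hlam
  have hlam0 : 0 < lam := pow_pos (cfEig_pos a) n
  have hhx : 0 < h x := cfHfun_pos hA hne ha hx
  have hp0 : 0 < lam * h x := mul_pos hlam0 hhx
  -- termwise derivatives
  choose D hD hDle using fun w : Fin n → A => exists_hasDerivWithinAt_term hA hne ha b w hf hx
  -- the sum `S` and its derivative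
  set S : ℝ → ℂ := fun y => ∑ w : Fin n → A, cfWt s (cfMat fun i => (w i : ℕ)) y *
    (((h (cfMoeb (cfMat fun i => (w i : ℕ)) y) : ℝ) : ℂ) * f (cfMoeb (cfMat fun i => (w i : ℕ)) y)) with hS
  have hSd : HasDerivWithinAt S (∑ w : Fin n → A, D w) (Icc (0 : ℝ) 1) x :=
    hasDerivWithinAt_fun_sum Finset.univ fun w _ => hD w
  -- the prefactor `p = (λ^n h)⁻¹` and its derivative
  have hpd : HasDerivWithinAt (fun y => (((lam * h y)⁻¹ : ℝ) : ℂ)) ((( -(lam * h' x) / (lam * h x) ^ 2 : ℝ)) : ℂ) (Icc (0 : ℝ) 1) x := by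
    have h1 := ((hasDerivWithinAt_cfHfun hA hne ha hx).const_mul lam).inv hp0.ne'
    exact h1.ofReal_comp
  have hprod := hpd.fun_mul hSd
  have heq : cfLRn hA hne ha b n f = fun y => (((lam * h y)⁻¹ : ℝ) : ℂ) * S y := by
    funext y; simp only [cfLRn, hS, hlam, hh, hs]
  refine ⟨_, by rw [heq]; exact hprod, ?_⟩
  -- bounds: `‖S x‖ ≤ λ^n h(x) L̃_a^n‖f‖(x)` and `Σ‖D_w‖ ≤ λ^n h(x) (…)`
  have hSn : ‖S x‖ ≤ lam * h x * cfLRa hA hne ha n (fun y => ‖f y‖) x := by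
    have h1 := norm_cfLRn_le hA hne ha b n f hx
    have e : cfLRn hA hne ha b n f x = (((lam * h x)⁻¹ : ℝ) : ℂ) * S x := by rw [heq]
    rw [e, norm_mul, Complex.norm_real, Real.norm_eq_abs, abs_of_pos (inv_pos.2 hp0)] at h1
    rwa [inv_mul_le_iff₀ hp0] at h1
  have hDsum : ∑ w : Fin n → A, ‖D w‖ ≤ lam * h x * ((2 * ‖s‖ + 2 * a) * cfLRa hA hne ha n (fun y => ‖f y‖) x +
      2 * (1 / 2) ^ n * cfLRa hA hne ha n (fun y => ‖f' y‖) x) := by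
    have e : lam * h x * ((2 * ‖s‖ + 2 * a) * cfLRa hA hne ha n (fun y => ‖f y‖) x +
        2 * (1 / 2) ^ n * cfLRa hA hne ha n (fun y => ‖f' y‖) x) =
        ∑ w : Fin n → A, cfRealWt a w x * h (cfMoeb (cfMat fun i => (w i : ℕ)) x) *
          ((2 * ‖s‖ + 2 * a) * ‖f (cfMoeb (cfMat fun i => (w i : ℕ)) x)‖ + 2 * (1 / 2) ^ n * ‖f' (cfMoeb (cfMat fun i => (w i : ℕ)) x)‖) := by
      simp only [cfLRa, ← hlam, ← hh, Finset.mul_sum, ← Finset.sum_add_distrib]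
      refine Finset.sum_congr rfl fun w _ => ?_
      field_simp
    rw [e]
    exact Finset.sum_le_sum fun w _ => hDle w
  -- `‖p' S + p S'‖`
  have hh'x : |h' x| ≤ 2 * a * h x := abs_cfHder_le hA hne ha hx
  refine (norm_add_le _ _).trans ?_
  rw [norm_mul, norm_mul, Complex.norm_real, Complex.norm_real, Real.norm_eq_abs, Real.norm_eq_abs,
    abs_of_pos (inv_pos.2 hp0), abs_div, abs_neg, abs_mul, abs_of_pos hlam0, abs_of_pos (pow_pos hp0 2)]
  have hT1 : lam * |h' x| / (lam * h x) ^ 2 * ‖S x‖ ≤ 2 * a * cfLRa hA hne ha n (fun y => ‖f y‖) x := by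
    rw [div_mul_eq_mul_div, div_le_iff₀ (pow_pos hp0 2)]
    have hL0 : 0 ≤ cfLRa hA hne ha n (fun y => ‖f y‖) x := cfLRa_nonneg hA hne ha (fun y _ => norm_nonneg _) hx n
    calc lam * |h' x| * ‖S x‖ ≤ lam * (2 * a * h x) * (lam * h x * cfLRa hA hne ha n (fun y => ‖f y‖) x) := by
          gcongr
      _ = 2 * a * cfLRa hA hne ha n (fun y => ‖f y‖) x * (lam * h x) ^ 2 := by ring
  have hT2 : (lam * h x)⁻¹ * ‖∑ w : Fin n → A, D w‖ ≤ (2 * ‖s‖ + 2 * a) * cfLRa hA hne ha n (fun y => ‖f y‖) x +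
      2 * (1 / 2) ^ n * cfLRa hA hne ha n (fun y => ‖f' y‖) x := by
    rw [inv_mul_le_iff₀ hp0]
    exact (norm_sum_le _ _).trans hDsum
  calc lam * |h' x| / (lam * h x) ^ 2 * ‖S x‖ + (lam * h x)⁻¹ * ‖∑ w : Fin n → A, D w‖
      ≤ 2 * a * cfLRa hA hne ha n (fun y => ‖f y‖) x + ((2 * ‖s‖ + 2 * a) * cfLRa hA hne ha n (fun y => ‖f y‖) x +
          2 * (1 / 2) ^ n * cfLRa hA hne ha n (fun y => ‖f' y‖) x) := add_le_add hT1 hT2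
    _ = (4 * a + 2 * ‖s‖) * cfLRa hA hne ha n (fun y => ‖f y‖) x + 2 * (1 / 2) ^ n * cfLRa hA hne ha n (fun y => ‖f' y‖) x := by
        ring

end APriori

/-! ### The a priori sup bound at `a = δ_A` (Lemma 23 (2)) -/

section Delta

variable (h2 : 2 ≤ A.card)

include hA in
/-- `h_a` is Lipschitz on `[0,1]` with constant `2a·4^a` (mean value theorem and the cone bound). [folklore] -/
theorem abs_cfHfun_sub_le (hne : A.Nonempty) {a : ℝ} (ha : 0 ≤ a) {x y : ℝ} (hx : x ∈ Icc (0 : ℝ) 1) (hy : y ∈ Icc (0 : ℝ) 1) :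
    |cfHfun hA hne ha x - cfHfun hA hne ha y| ≤ 2 * a * (4 : ℝ) ^ a * |x - y| := by
  have hb : ∀ z ∈ Icc (0 : ℝ) 1, ‖cfHder hA hne ha z‖ ≤ 2 * a * (4 : ℝ) ^ a := fun z hz => by
    rw [Real.norm_eq_abs]
    exact (abs_cfHder_le hA hne ha hz).trans (mul_le_mul_of_nonneg_left (cfHfun_le hA hne ha hz) (by positivity))
  have h := (convex_Icc (0 : ℝ) 1).norm_image_sub_le_of_norm_hasDerivWithin_le
    (fun z hz => hasDerivWithinAt_cfHfun hA hne ha hz) hb hy hx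
  rwa [Real.norm_eq_abs, Real.norm_eq_abs] at h

include hA h2 in
/-- **At `a = δ_A` the chosen `C¹` eigenfunction is a positive multiple of the RPF eigenfunction `h` of the tree**
(uniqueness of positive Lipschitz eigenfunctions). [cite: MageeOhWinter2019, Thm. 10 (3)] -/
theorem exists_cfHfun_eq_mul_cfHδ :
    ∃ t : ℝ, 0 < t ∧ ∀ x ∈ Icc (0 : ℝ) 1,
      cfHfun hA (nonempty_of_two_le_card h2) (cfDimension_pos hA h2).le x = t * cfHδ A hA h2 x := by
  set hne := nonempty_of_two_le_card h2
  set hδ := (cfDimension_pos hA h2).le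
  obtain ⟨t, ht⟩ := cfTransfer_eigenfunction_unique hA hne hδ
    (fun x hx y hy => abs_cfHfun_sub_le hA hne hδ hx hy) (fun x hx y hy => abs_cfHδ_sub_le A hA h2 hx hy)
    (fun x hx => cfHδ_pos A hA h2 hx) (fun x hx => cfTransfer_cfHfun hA hne hδ hx) ((cfRPF_spec A hA h2).2.2.2.1)
  refine ⟨t, ?_, ht⟩
  have h0 : (0 : ℝ) ∈ Icc (0 : ℝ) 1 := ⟨le_rfl, zero_le_one⟩
  have h1 := cfHfun_pos hA hne hδ h0
  rw [ht 0 h0] at h1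
  exact pos_of_mul_pos_left h1 (cfHδ_pos A hA h2 h0).le

include hA h2 in
/-- **The a priori sup bound [MageeOhWinter2019, Lemma 23 (2)]** (scalar letter operator, explicit constants):
for a real `g` on `[0,1]` with `|g| ≤ M` and Lipschitz constant `L`,
`|L̃_δ^n g (x) - ∫ g h dν| ≤ κ₂ θⁿ (M + L)` on `[0,1]`, where `h dν = dν₀` is the Gibbs probability measure
(`ν(h) = 1`), `θ = cfTheta δ < 1`, `κ₂ = e^{2δ} C_gap (e^{2δ} + 2δ e^{4δ})`. [cite: MageeOhWinter2019, Lemma 23 (2)] -/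
theorem abs_cfLRa_delta_sub_le {g : ℝ → ℝ} {M L : ℝ} (hM : 0 ≤ M) (hL : 0 ≤ L)
    (hgM : ∀ y ∈ Icc (0 : ℝ) 1, |g y| ≤ M) (hgL : ∀ x ∈ Icc (0 : ℝ) 1, ∀ y ∈ Icc (0 : ℝ) 1, |g x - g y| ≤ L * |x - y|)
    (n : ℕ) {x : ℝ} (hx : x ∈ Icc (0 : ℝ) 1) :
    |cfLRa hA (nonempty_of_two_le_card h2) (cfDimension_pos hA h2).le n g x -
        cfInt (cfNuδ A hA h2) (fun y => cfHδ A hA h2 y * g y)| ≤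
      Real.exp (2 * cfDimension A) * cfGapConst (cfDimension A) *
        (Real.exp (2 * cfDimension A) + 2 * cfDimension A * Real.exp (2 * cfDimension A) * Real.exp (2 * cfDimension A)) *
        cfTheta (cfDimension A) ^ n * (M + L) := by
  set δ := cfDimension A with hδdef
  set hne := nonempty_of_two_le_card h2
  set hδ := (cfDimension_pos hA h2).le
  set h₀ := cfHδ A hA h2 with hh₀
  set E := Real.exp (2 * δ) with hE
  set Lh : ℝ := 2 * δ * E * E with hLh
  obtain ⟨t, ht0, ht⟩ := exists_cfHfun_eq_mul_cfHδ hA h2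
  have hlam1 : cfEig A δ ^ n = 1 := by rw [hδdef, cfEig_cfDimension hA h2, one_pow]
  have hh₀x : 0 < h₀ x := cfHδ_pos A hA h2 hx
  -- `L̃_δ^n g (x) = h₀(x)⁻¹ λ^{-n} L^n(h₀ g)(x)`
  have hsum : ∑ w : Fin n → A, cfRealWt δ w x * cfHfun hA hne hδ (cfMoeb (cfMat fun i => (w i : ℕ)) x) *
      g (cfMoeb (cfMat fun i => (w i : ℕ)) x) = t * (cfTransfer A δ)^[n] (fun y => h₀ y * g y) x := by
    rw [cfTransfer_iterate hA δ _ n hx, cfTransferSum, Finset.mul_sum]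
    refine Finset.sum_congr rfl fun w _ => ?_
    rw [ht _ (cfMoeb_cfMat_mem (one_le_coe_digit hA w) hx), cfRealWt]
    ring
  have hval : cfLRa hA hne hδ n g x = (h₀ x)⁻¹ * (cfTransfer A δ)^[n] (fun y => h₀ y * g y) x := by
    unfold cfLRa
    rw [hsum, ht x hx, ← hh₀, cfEig_cfDimension hA h2, one_pow, one_mul]
    field_simp
  -- bounds for `h₀ g`
  have hE1 : ∀ y ∈ Icc (0 : ℝ) 1, h₀ y ≤ E := fun y hy => cfHδ_le A hA h2 hy
  have hM' : ∀ y ∈ Icc (0 : ℝ) 1, |h₀ y * g y| ≤ E * M := fun y hy => by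
    rw [abs_mul, abs_of_pos (cfHδ_pos A hA h2 hy)]
    exact mul_le_mul (hE1 y hy) (hgM y hy) (abs_nonneg _) (by positivity)
  have hL' : ∀ u ∈ Icc (0 : ℝ) 1, ∀ v ∈ Icc (0 : ℝ) 1, |h₀ u * g u - h₀ v * g v| ≤ (E * L + Lh * M) * |u - v| := by
    intro u hu v hv
    have e : h₀ u * g u - h₀ v * g v = h₀ u * (g u - g v) + (h₀ u - h₀ v) * g v := by ring
    rw [e]
    refine (abs_add_le _ _).trans ?_
    rw [abs_mul, abs_mul, abs_of_pos (cfHδ_pos A hA h2 hu)]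
    have h1 : h₀ u * |g u - g v| ≤ E * (L * |u - v|) :=
      mul_le_mul (hE1 u hu) (hgL u hu v hv) (abs_nonneg _) (by positivity)
    have h2' : |h₀ u - h₀ v| * |g v| ≤ (Lh * |u - v|) * M :=
      mul_le_mul (abs_cfHδ_sub_le A hA h2 hu hv) (hgM v hv) (abs_nonneg _) (by positivity)
    nlinarith [h1, h2']
  have hdec := cfHδ_decay A hA h2 (f := fun y => h₀ y * g y) (by positivity : 0 ≤ E * M)
    (by positivity : 0 ≤ E * L + Lh * M) hM' hL' n hx
  -- divide by `h₀ x ≥ e^{-2δ}`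
  have hlow : E⁻¹ ≤ h₀ x := by rw [hE, ← Real.exp_neg]; exact le_cfHδ A hA h2 hx
  have hinv : (h₀ x)⁻¹ ≤ E := by
    have := inv_anti₀ (inv_pos.2 (Real.exp_pos _)) hlow  -- (h₀ x)⁻¹ ≤ (E⁻¹)⁻¹
    rwa [inv_inv] at this
  rw [hval]
  have e : (h₀ x)⁻¹ * (cfTransfer A δ)^[n] (fun y => h₀ y * g y) x - cfInt (cfNuδ A hA h2) (fun y => h₀ y * g y) =
      (h₀ x)⁻¹ * ((cfTransfer A δ)^[n] (fun y => h₀ y * g y) x - cfInt (cfNuδ A hA h2) (fun y => h₀ y * g y) * h₀ x) := by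
    field_simp
  rw [e, abs_mul, abs_of_pos (inv_pos.2 hh₀x)]
  have hC0 : 0 ≤ cfGapConst δ := (cfGapConst_pos hδ).le
  have hθ0 : 0 ≤ cfTheta δ ^ n := pow_nonneg (cfTheta_pos hδ).le n
  calc (h₀ x)⁻¹ * |(cfTransfer A δ)^[n] (fun y => h₀ y * g y) x - cfInt (cfNuδ A hA h2) (fun y => h₀ y * g y) * h₀ x|
      ≤ E * (cfGapConst δ * cfTheta δ ^ n * (E * M + (E * L + Lh * M))) :=
        mul_le_mul hinv hdec (abs_nonneg _) (Real.exp_pos _).le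
    _ ≤ E * cfGapConst δ * (E + Lh) * cfTheta δ ^ n * (M + L) := by
        have hLh0 : 0 ≤ Lh := by rw [hLh]; have := cfDimension_pos hA h2; positivity
        have : E * M + (E * L + Lh * M) ≤ (E + Lh) * (M + L) := by nlinarith [mul_nonneg hLh0 hL]
        have h1 := mul_le_mul_of_nonneg_left this (by positivity : 0 ≤ E * (cfGapConst δ * cfTheta δ ^ n))
        nlinarith [h1]

end Delta

end Literature.NumberTheory.Sieve
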